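import Summits.AtomisticToContinuum.BoseEinsteinCondensation.Theorems.BECHardSphereReductionZeroModeSlices
import Summits.AtomisticToContinuum.BoseEinsteinCondensation.Theorems.BECInfraredBoundAssembly
import Literature.MathematicalPhysics.QuantumManyBody.BosonicFloorSymmetrisation
import HarnessLib

/-!
# Crux `HardSphereBEC` (stmt-AtomisticToContinuum-11885), line `birth` (skeleton v5):
# the registered stub `stub_sectorOccupation` (T1)

Supports (does not close) stmt-AtomisticToContinuum-11885; stub `stub_sectorOccupation` of the
birth line (lead c8, skeleton v5). **Phase-sector occupation inequality.** For a continuous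
`N`-body wave function `Θ` vanishing off the box `Λ_L^N` (`L > 0`), split into its four phase
sectors `P₁ = (Re Θ)⁺`, `P₂ = (Re Θ)⁻`, `P₃ = (Im Θ)⁺`, `P₄ = (Im Θ)⁻` (complexified), the
occupations of the flat mode `φ₀ = L^{-3/2}·1_{Λ_L}` satisfy

  `2 Σ_j ⟨φ₀, γ_{P_j} φ₀⟩ ≤ ⟨φ₀, γ_Θ φ₀⟩ + N ∫ |Θ|²`.

Proof. *One body* (`SectorOccupation.two_mul_sum_sq_le`): for `u : ℝ³ → ℂ` continuous and
vanishing off `Λ_L`, with `A = ∫ (Re u)⁺, B = ∫ (Re u)⁻, C = ∫ (Im u)⁺, D = ∫ (Im u)⁻`,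
`‖∫ u‖² = (A - B)² + (C - D)²` and `(A + B)² + (C + D)² = ‖∫ (|Re u| + i |Im u|)‖² ≤ (∫ ‖u‖)²`
(norm of the integral at most the integral of the norm, and `‖|Re u| + i|Im u|‖ = ‖u‖`), whence
`2 (A² + B² + C² + D²) ≤ ‖∫ u‖² + (∫ ‖u‖)²`; and `(∫ ‖u‖)² ≤ L³ ∫ ‖u‖²` (Cauchy–Schwarz on the
box, `|Λ_L| = L³`). *N body*: against the flat mode every function `F` vanishing off `Λ_L^N` has
`⟨φ₀, γ_F φ₀⟩ = N · L⁻³ · ∫ ‖∫ F(x, Y) dx‖² dY` (`SectorOccupation.occupation_flatMode_eq`); the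
sectors of `Θ` restricted to a slice `u_Y = Θ(·, Y)` are the sectors of the slice, so the
one-body inequality for `u_Y`, multiplied by `L⁻³` and integrated `dY`, gives the claim, the last
term being `N ∫ (∫ |Θ(x, Y)|² dx) dY = N ∫ |Θ|²` (Tonelli, `lintegral_lintegral_sq_nnnorm_vecCons`).
-/

noncomputable section

open MeasureTheory
open scoped ENNReal NNReal ComplexConjugate

namespace Summit.AtomisticToContinuum.BoseEinsteinCondensation.Cruxes.HardSphereBEC.Birth

open Literature.MathematicalPhysics.QuantumManyBody.BoseGas

namespace SectorOccupation

variable {L : ℝ}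

/-! ### One-body facts on the box `Λ_L ⊂ ℝ³` -/

/-- A function on `ℝ³` vanishing off the (bounded) box `Λ_L` has compact support. [folklore] -/
theorem hasCompactSupport_of_box {E : Type*} [Zero E] {g : Space → E}
    (h0 : ∀ x, x ∉ box L → g x = 0) : HasCompactSupport g :=
  HasCompactSupport.intro (isCompact_closedBall (0 : Space) (2 * L)) fun x hx =>
    h0 x fun hx' => hx (box_subset_closedBall L hx')

/-- A continuous function on `ℝ³` vanishing off the box `Λ_L` is integrable. [folklore] -/
theorem integrable_of_box {E : Type*} [NormedAddCommGroup E] {g : Space → E} (hg : Continuous g)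
    (h0 : ∀ x, x ∉ box L → g x = 0) : Integrable g :=
  hg.integrable_of_hasCompactSupport (hasCompactSupport_of_box h0)

variable {u : Space → ℂ}

/-- **One-body sector inequality (real form).** For a continuous `u : ℝ³ → ℂ` vanishing off the
box, with `A = ∫ (Re u)⁺, B = ∫ (Re u)⁻, C = ∫ (Im u)⁺, D = ∫ (Im u)⁻`:
`2 (A² + B² + C² + D²) ≤ ‖∫ u‖² + (∫ ‖u‖)²`, because `‖∫ u‖² = (A - B)² + (C - D)²` and
`(A + B)² + (C + D)² = ‖∫ (|Re u| + i|Im u|)‖² ≤ (∫ ‖u‖)²`. [folklore] -/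
theorem two_mul_sum_sq_le (hu : Continuous u) (h0 : ∀ x, x ∉ box L → u x = 0) :
    2 * ((∫ x, max (u x).re 0) ^ 2 + (∫ x, max (-(u x).re) 0) ^ 2 +
        (∫ x, max (u x).im 0) ^ 2 + (∫ x, max (-(u x).im) 0) ^ 2) ≤
      ‖∫ x, u x‖ ^ 2 + (∫ x, ‖u x‖) ^ 2 := by
  have hui : Integrable u := integrable_of_box hu h0
  have hre : Continuous fun x => (u x).re := Complex.continuous_re.comp hu
  have him : Continuous fun x => (u x).im := Complex.continuous_im.comp hu
  have h0re : ∀ x, x ∉ box L → (u x).re = 0 := fun x hx => by rw [h0 x hx, Complex.zero_re]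
  have h0im : ∀ x, x ∉ box L → (u x).im = 0 := fun x hx => by rw [h0 x hx, Complex.zero_im]
  have hAi : Integrable fun x => max (u x).re 0 :=
    integrable_of_box (hre.max continuous_const) fun x hx => by rw [h0re x hx, max_self]
  have hBi : Integrable fun x => max (-(u x).re) 0 :=
    integrable_of_box (hre.neg.max continuous_const) fun x hx => by
      rw [h0re x hx, neg_zero, max_self]
  have hCi : Integrable fun x => max (u x).im 0 :=
    integrable_of_box (him.max continuous_const) fun x hx => by rw [h0im x hx, max_self]
  have hDi : Integrable fun x => max (-(u x).im) 0 :=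
    integrable_of_box (him.neg.max continuous_const) fun x hx => by
      rw [h0im x hx, neg_zero, max_self]
  set A := ∫ x, max (u x).re 0 with hA
  set B := ∫ x, max (-(u x).re) 0 with hB
  set C := ∫ x, max (u x).im 0 with hC
  set D := ∫ x, max (-(u x).im) 0 with hD
  -- `∫ u = (A - B) + (C - D) i`
  have hIre : (∫ x, u x).re = A - B := by
    have h1 : (∫ x, u x).re = ∫ x, (u x).re := by simpa using (integral_re hui).symm
    rw [h1, hA, hB, ← integral_sub hAi hBi]
    exact integral_congr_ae (Filter.Eventually.of_forall fun x =>
      (max_zero_sub_max_neg_zero_eq_self _).symm)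
  have hIim : (∫ x, u x).im = C - D := by
    have h1 : (∫ x, u x).im = ∫ x, (u x).im := by simpa using (integral_im hui).symm
    rw [h1, hC, hD, ← integral_sub hCi hDi]
    exact integral_congr_ae (Filter.Eventually.of_forall fun x =>
      (max_zero_sub_max_neg_zero_eq_self _).symm)
  -- the vector `(|Re u|, |Im u|)` as the complex function `v = |Re u| + i |Im u|`
  set v : Space → ℂ := fun x => ((|(u x).re| : ℝ) : ℂ) + ((|(u x).im| : ℝ) : ℂ) * Complex.I
    with hv
  have hvc : Continuous v := by
    rw [hv]
    fun_prop
  have hv0 : ∀ x, x ∉ box L → v x = 0 := fun x hx => by simp [hv, h0 x hx]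
  have hvi : Integrable v := integrable_of_box hvc hv0
  have hvre : ∀ x, (v x).re = |(u x).re| := fun x => by simp [hv]
  have hvim : ∀ x, (v x).im = |(u x).im| := fun x => by simp [hv]
  have hvnorm : ∀ x, ‖v x‖ = ‖u x‖ := fun x => by
    rw [Complex.norm_def, Complex.norm_def, Complex.normSq_apply, Complex.normSq_apply, hvre, hvim,
      abs_mul_abs_self, abs_mul_abs_self]
  have hVre : (∫ x, v x).re = A + B := by
    have h1 : (∫ x, v x).re = ∫ x, (v x).re := by simpa using (integral_re hvi).symm
    rw [h1, hA, hB, ← integral_add hAi hBi]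
    exact integral_congr_ae (Filter.Eventually.of_forall fun x =>
      (hvre x).trans (max_zero_add_max_neg_zero_eq_abs_self _).symm)
  have hVim : (∫ x, v x).im = C + D := by
    have h1 : (∫ x, v x).im = ∫ x, (v x).im := by simpa using (integral_im hvi).symm
    rw [h1, hC, hD, ← integral_add hCi hDi]
    exact integral_congr_ae (Filter.Eventually.of_forall fun x =>
      (hvim x).trans (max_zero_add_max_neg_zero_eq_abs_self _).symm)
  have hVle : ‖∫ x, v x‖ ≤ ∫ x, ‖u x‖ :=
    calc ‖∫ x, v x‖ ≤ ∫ x, ‖v x‖ := norm_integral_le_integral_norm _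
      _ = ∫ x, ‖u x‖ := integral_congr_ae (Filter.Eventually.of_forall hvnorm)
  have h1 : ‖∫ x, u x‖ ^ 2 = (A - B) ^ 2 + (C - D) ^ 2 := by
    rw [Complex.sq_norm, Complex.normSq_apply, hIre, hIim]; ring
  have h2 : (A + B) ^ 2 + (C + D) ^ 2 ≤ (∫ x, ‖u x‖) ^ 2 := by
    have h3 : ‖∫ x, v x‖ ^ 2 = (A + B) ^ 2 + (C + D) ^ 2 := by
      rw [Complex.sq_norm, Complex.normSq_apply, hVre, hVim]; ring
    rw [← h3]
    exact pow_le_pow_left₀ (norm_nonneg _) hVle 2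
  calc 2 * (A ^ 2 + B ^ 2 + C ^ 2 + D ^ 2)
      = ((A - B) ^ 2 + (C - D) ^ 2) + ((A + B) ^ 2 + (C + D) ^ 2) := by ring
    _ ≤ ‖∫ x, u x‖ ^ 2 + (∫ x, ‖u x‖) ^ 2 := by rw [h1]; exact add_le_add le_rfl h2

/-- For `p : ℝ³ → ℝ`, the squared `ℝ≥0∞`-modulus of `∫ (p : ℂ)` is `ofReal ((∫ p)²)`
(`coe_nnnorm_pow_two_eq_ofReal` from `BosonicFloorSymmetrisation`). [folklore] -/
theorem coe_nnnorm_integral_ofReal_sq (p : Space → ℝ) :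
    ((‖∫ x, ((p x : ℝ) : ℂ)‖₊ : ℝ≥0∞)) ^ 2 = ENNReal.ofReal ((∫ x, p x) ^ 2) := by
  rw [integral_complex_ofReal, Complex.nnnorm_real, coe_nnnorm_pow_two_eq_ofReal, Real.norm_eq_abs,
    sq_abs]

/-- **Cauchy–Schwarz on the box**: `(∫ ‖u‖)² ≤ L³ ∫ ‖u‖²` in `ℝ≥0∞` for `u` vanishing off `Λ_L`
(`|Λ_L| = L³`). [folklore] -/
theorem lintegral_nnnorm_sq_le (hL : 0 ≤ L) (hum : AEMeasurable (fun x => (‖u x‖₊ : ℝ≥0∞)))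
    (h0 : ∀ x, x ∉ box L → u x = 0) :
    (∫⁻ x, (‖u x‖₊ : ℝ≥0∞)) ^ 2 ≤ ENNReal.ofReal (L ^ 3) * ∫⁻ x, ((‖u x‖₊ : ℝ≥0∞)) ^ 2 := by
  have hind : ∀ x, (box L).indicator (fun _ => (1 : ℝ≥0∞)) x * (‖u x‖₊ : ℝ≥0∞) = ‖u x‖₊ := by
    intro x
    by_cases hx : x ∈ box L
    · rw [Set.indicator_of_mem hx, one_mul]
    · rw [h0 x hx, nnnorm_zero, ENNReal.coe_zero, mul_zero]
  have hind2 : ∀ x, ((box L).indicator (fun _ => (1 : ℝ≥0∞)) x) ^ 2 =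
      (box L).indicator (fun _ => (1 : ℝ≥0∞)) x := by
    intro x
    by_cases hx : x ∈ box L
    · rw [Set.indicator_of_mem hx, one_pow]
    · rw [Set.indicator_of_notMem hx, zero_pow two_ne_zero]
  have h1 := lintegral_mul_sq_le volume (f := (box L).indicator fun _ => (1 : ℝ≥0∞))
    (g := fun x => (‖u x‖₊ : ℝ≥0∞))
    (aemeasurable_const.indicator (_root_.AtomisticToContinuum.BECInfraredBound.measurableSet_box L))
    hum
  simp_rw [hind, hind2] at h1
  refine h1.trans (le_of_eq ?_)
  rw [lintegral_indicator (_root_.AtomisticToContinuum.BECInfraredBound.measurableSet_box L),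
    setLIntegral_const, one_mul, _root_.AtomisticToContinuum.BECInfraredBound.volume_box,
    ENNReal.ofReal_pow hL]

/-- **One-body sector inequality (`ℝ≥0∞` form)**: for `u : ℝ³ → ℂ` continuous and vanishing off
`Λ_L` (`L ≥ 0`), `2 Σ_j ‖∫ P_j(u)‖² ≤ ‖∫ u‖² + L³ ∫ ‖u‖²` over the four phase sectors
`(Re u)⁺, (Re u)⁻, (Im u)⁺, (Im u)⁻`. [folklore] -/
theorem oneBody (hL : 0 ≤ L) (hu : Continuous u) (h0 : ∀ x, x ∉ box L → u x = 0) :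
    2 * (((‖∫ x, ((max (u x).re 0 : ℝ) : ℂ)‖₊ : ℝ≥0∞)) ^ 2 +
        ((‖∫ x, ((max (-(u x).re) 0 : ℝ) : ℂ)‖₊ : ℝ≥0∞)) ^ 2 +
        ((‖∫ x, ((max (u x).im 0 : ℝ) : ℂ)‖₊ : ℝ≥0∞)) ^ 2 +
        ((‖∫ x, ((max (-(u x).im) 0 : ℝ) : ℂ)‖₊ : ℝ≥0∞)) ^ 2) ≤
      ((‖∫ x, u x‖₊ : ℝ≥0∞)) ^ 2 + ENNReal.ofReal (L ^ 3) * ∫⁻ x, ((‖u x‖₊ : ℝ≥0∞)) ^ 2 := by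
  have hui : Integrable u := integrable_of_box hu h0
  calc 2 * (((‖∫ x, ((max (u x).re 0 : ℝ) : ℂ)‖₊ : ℝ≥0∞)) ^ 2 +
        ((‖∫ x, ((max (-(u x).re) 0 : ℝ) : ℂ)‖₊ : ℝ≥0∞)) ^ 2 +
        ((‖∫ x, ((max (u x).im 0 : ℝ) : ℂ)‖₊ : ℝ≥0∞)) ^ 2 +
        ((‖∫ x, ((max (-(u x).im) 0 : ℝ) : ℂ)‖₊ : ℝ≥0∞)) ^ 2)
      = ENNReal.ofReal (2 * ((∫ x, max (u x).re 0) ^ 2 + (∫ x, max (-(u x).re) 0) ^ 2 +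
          (∫ x, max (u x).im 0) ^ 2 + (∫ x, max (-(u x).im) 0) ^ 2)) := by
        rw [coe_nnnorm_integral_ofReal_sq, coe_nnnorm_integral_ofReal_sq,
          coe_nnnorm_integral_ofReal_sq, coe_nnnorm_integral_ofReal_sq,
          ← ENNReal.ofReal_add (sq_nonneg _) (sq_nonneg _),
          ← ENNReal.ofReal_add (by positivity) (sq_nonneg _),
          ← ENNReal.ofReal_add (by positivity) (sq_nonneg _),
          ENNReal.ofReal_mul (by norm_num : (0 : ℝ) ≤ 2), ENNReal.ofReal_ofNat]
    _ ≤ ENNReal.ofReal (‖∫ x, u x‖ ^ 2 + (∫ x, ‖u x‖) ^ 2) :=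
        ENNReal.ofReal_le_ofReal (two_mul_sum_sq_le hu h0)
    _ = ((‖∫ x, u x‖₊ : ℝ≥0∞)) ^ 2 + (∫⁻ x, (‖u x‖₊ : ℝ≥0∞)) ^ 2 := by
        rw [ENNReal.ofReal_add (sq_nonneg _) (sq_nonneg _), ← coe_nnnorm_pow_two_eq_ofReal,
          ENNReal.ofReal_pow (integral_nonneg fun _ => norm_nonneg _),
          ofReal_integral_norm_eq_lintegral_enorm hui]
        rfl
    _ ≤ ((‖∫ x, u x‖₊ : ℝ≥0∞)) ^ 2 + ENNReal.ofReal (L ^ 3) * ∫⁻ x, ((‖u x‖₊ : ℝ≥0∞)) ^ 2 :=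
        add_le_add le_rfl
          (lintegral_nnnorm_sq_le hL hu.measurable.nnnorm.coe_nnreal_ennreal.aemeasurable h0)

/-! ### The `dY`-bookkeeping -/

/-- A pointwise bound `2 Σ_j F_j ≤ G + d·H` integrates to `2 Σ_j N c ∫F_j ≤ N c ∫G + N ∫H` when
`c d = 1` (`H` measurable; only the free direction of additivity is used on the left). [folklore] -/
theorem combine {α : Type*} [MeasurableSpace α] {μ : Measure α} {F₁ F₂ F₃ F₄ G H : α → ℝ≥0∞}
    {c d : ℝ≥0∞} (N : ℝ≥0∞) (hH : Measurable H) (hcd : c * d = 1)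
    (key : ∀ a, 2 * (F₁ a + F₂ a + F₃ a + F₄ a) ≤ G a + d * H a) :
    2 * (N * (c * ∫⁻ a, F₁ a ∂μ) + N * (c * ∫⁻ a, F₂ a ∂μ) + N * (c * ∫⁻ a, F₃ a ∂μ) +
        N * (c * ∫⁻ a, F₄ a ∂μ)) ≤ N * (c * ∫⁻ a, G a ∂μ) + N * ∫⁻ a, H a ∂μ := by
  have hsum : ∫⁻ a, F₁ a ∂μ + ∫⁻ a, F₂ a ∂μ + ∫⁻ a, F₃ a ∂μ + ∫⁻ a, F₄ a ∂μ ≤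
      ∫⁻ a, (F₁ a + F₂ a + F₃ a + F₄ a) ∂μ :=
    calc ∫⁻ a, F₁ a ∂μ + ∫⁻ a, F₂ a ∂μ + ∫⁻ a, F₃ a ∂μ + ∫⁻ a, F₄ a ∂μ
        ≤ ∫⁻ a, (F₁ a + F₂ a) ∂μ + ∫⁻ a, F₃ a ∂μ + ∫⁻ a, F₄ a ∂μ := by
          gcongr ?_ + _ + _
          exact le_lintegral_add _ _
      _ ≤ ∫⁻ a, (F₁ a + F₂ a + F₃ a) ∂μ + ∫⁻ a, F₄ a ∂μ := by
          gcongr ?_ + _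
          exact le_lintegral_add _ _
      _ ≤ _ := le_lintegral_add _ _
  have h2 : 2 * ∫⁻ a, (F₁ a + F₂ a + F₃ a + F₄ a) ∂μ ≤ ∫⁻ a, (G a + d * H a) ∂μ := by
    rw [← lintegral_const_mul' _ _ ENNReal.ofNat_ne_top]
    exact lintegral_mono fun a => key a
  have h3 : ∫⁻ a, (G a + d * H a) ∂μ = ∫⁻ a, G a ∂μ + d * ∫⁻ a, H a ∂μ := by
    rw [lintegral_add_right _ (hH.const_mul d), lintegral_const_mul d hH]
  calc 2 * (N * (c * ∫⁻ a, F₁ a ∂μ) + N * (c * ∫⁻ a, F₂ a ∂μ) + N * (c * ∫⁻ a, F₃ a ∂μ) +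
        N * (c * ∫⁻ a, F₄ a ∂μ))
      = N * (c * (2 * (∫⁻ a, F₁ a ∂μ + ∫⁻ a, F₂ a ∂μ + ∫⁻ a, F₃ a ∂μ + ∫⁻ a, F₄ a ∂μ))) := by
        ring
    _ ≤ N * (c * (2 * ∫⁻ a, (F₁ a + F₂ a + F₃ a + F₄ a) ∂μ)) := by gcongr
    _ ≤ N * (c * ∫⁻ a, (G a + d * H a) ∂μ) := by gcongr
    _ = N * (c * ∫⁻ a, G a ∂μ) + N * ∫⁻ a, H a ∂μ := by
        rw [h3, mul_add c, ← mul_assoc c d, hcd, one_mul, mul_add]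

/-! ### `N`-body: the flat-mode occupation as a slice functional -/

variable {n : ℕ}

/-- The slice `x ↦ F(x, Y)` of a function vanishing off `Λ_L^{n+1}` vanishes off `Λ_L`. [folklore] -/
theorem slice_eq_zero {F : Config (n + 1) → ℂ} (hF : ∀ X, X ∉ boxN (n + 1) L → F X = 0)
    (Y : Config n) {x : Space} (hx : x ∉ box L) : F (Matrix.vecCons x Y) = 0 :=
  hF _ fun h => hx (by simpa using h 0)

/-- Against the flat mode the integrand is `L^{-3/2} F(x, Y)` for every `x`, for any `F`
vanishing off `Λ_L^{n+1}` (both sides vanish off the box). [folklore] -/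
theorem conj_flatMode_mul {F : Config (n + 1) → ℂ} (hF : ∀ X, X ∉ boxN (n + 1) L → F X = 0)
    (Y : Config n) (x : Space) :
    conj ((box L).indicator (fun _ => ((Real.sqrt (L ^ 3))⁻¹ : ℂ)) x) * F (Matrix.vecCons x Y) =
      ((Real.sqrt (L ^ 3))⁻¹ : ℂ) * F (Matrix.vecCons x Y) := by
  by_cases hx : x ∈ box L
  · rw [Set.indicator_of_mem hx, map_inv₀, Complex.conj_ofReal]
  · rw [Set.indicator_of_notMem hx, map_zero, slice_eq_zero hF Y hx, mul_zero, mul_zero]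

/-- **The flat-mode occupation is a slice functional**: for any `F` vanishing off `Λ_L^{n+1}`
(`L > 0`), `⟨φ₀, γ_F φ₀⟩ = (n+1) · L⁻³ · ∫ ‖∫ F(x, Y) dx‖² dY`. [folklore] -/
theorem occupation_flatMode_eq (hL : 0 < L) {F : Config (n + 1) → ℂ}
    (hF : ∀ X, X ∉ boxN (n + 1) L → F X = 0) :
    occupation (n + 1) ((box L).indicator fun _ => ((Real.sqrt (L ^ 3))⁻¹ : ℂ)) F =
      (n + 1 : ℝ≥0∞) * (ENNReal.ofReal ((L ^ 3)⁻¹) *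
        ∫⁻ Y : Config n, (‖∫ x, F (Matrix.vecCons x Y)‖₊ : ℝ≥0∞) ^ 2) := by
  change (n + 1 : ℝ≥0∞) * ∫⁻ Y : Config n,
      (‖∫ x, conj ((box L).indicator (fun _ => ((Real.sqrt (L ^ 3))⁻¹ : ℂ)) x) *
        F (Matrix.vecCons x Y)‖₊ : ℝ≥0∞) ^ 2 = _
  congr 1
  simp_rw [conj_flatMode_mul hF, integral_const_mul, nnnorm_mul, ENNReal.coe_mul, mul_pow,
    Theorems.nnnorm_constMode_sq hL]
  rw [lintegral_const_mul' _ _ ENNReal.ofReal_ne_top]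

end SectorOccupation

open SectorOccupation in
/-- **T1 — PHASE-SECTOR OCCUPATION INEQUALITY.** For `L > 0` and a continuous `Θ : (ℝ³)^N → ℂ`
vanishing off `Λ_L^N`, with phase sectors `P₁ = (Re Θ)⁺, P₂ = (Re Θ)⁻, P₃ = (Im Θ)⁺, P₄ = (Im Θ)⁻`
and the flat mode `φ₀ = L^{-3/2}·1_{Λ_L}`:
`2 Σ_j ⟨φ₀, γ_{P_j} φ₀⟩ ≤ ⟨φ₀, γ_Θ φ₀⟩ + N ∫ |Θ|²`.
Slice-wise (`u = Θ(·, Y)`, `A_j = ∫P_j(u)`): `|∫u|² = (A₁−A₂)² + (A₃−A₄)²`,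
`(∫|u|)² ≥ (A₁+A₂)² + (A₃+A₄)²` (norm of the integral of the vector `(|Re u|, |Im u|)` ≤ integral of its
norm), `(∫|u|)² ≤ L³∫|u|²`; then integrate `dY` (`occupation_constMode_eq_slices` pattern). [folklore] -/
theorem stub_sectorOccupation : ∀ (N : ℕ) (L : ℝ), 0 < L → ∀ Θ : Literature.MathematicalPhysics.QuantumManyBody.BoseGas.Config N → ℂ, Continuous Θ → (∀ X, X ∉ Literature.MathematicalPhysics.QuantumManyBody.BoseGas.boxN N L → Θ X = 0) → 2 * (Literature.MathematicalPhysics.QuantumManyBody.BoseGas.occupation N ((Literature.MathematicalPhysics.QuantumManyBody.BoseGas.box L).indicator fun _ => ((Real.sqrt (L ^ 3))⁻¹ : ℂ)) (fun X => ((max (Θ X).re 0 : ℝ) : ℂ)) + Literature.MathematicalPhysics.QuantumManyBody.BoseGas.occupation N ((Literature.MathematicalPhysics.QuantumManyBody.BoseGas.box L).indicator fun _ => ((Real.sqrt (L ^ 3))⁻¹ : ℂ)) (fun X => ((max (-(Θ X).re) 0 : ℝ) : ℂ)) + Literature.MathematicalPhysics.QuantumManyBody.BoseGas.occupation N ((Literature.MathematicalPhysics.QuantumManyBody.BoseGas.box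 L).indicator fun _ => ((Real.sqrt (L ^ 3))⁻¹ : ℂ)) (fun X => ((max (Θ X).im 0 : ℝ) : ℂ)) + Literature.MathematicalPhysics.QuantumManyBody.BoseGas.occupation N ((Literature.MathematicalPhysics.QuantumManyBody.BoseGas.box L).indicator fun _ => ((Real.sqrt (L ^ 3))⁻¹ : ℂ)) (fun X => ((max (-(Θ X).im) 0 : ℝ) : ℂ))) ≤ Literature.MathematicalPhysics.QuantumManyBody.BoseGas.occupation N ((Literature.MathematicalPhysics.QuantumManyBody.BoseGas.box L).indicator fun _ => ((Real.sqrt (L ^ 3))⁻¹ : ℂ)) Θ + (N : ENNReal) * ∫⁻ X, (‖Θ X‖₊ : ENNReal) ^ 2 := by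
  intro N L hL Θ hΘ hΘ0
  cases N with
  | zero => simp [occupation]
  | succ n =>
    -- the four sectors vanish off the box, like `Θ`
    have h1 : ∀ X, X ∉ boxN (n + 1) L → (fun X => ((max (Θ X).re 0 : ℝ) : ℂ)) X = 0 :=
      fun X hX => by simp [hΘ0 X hX]
    have h2 : ∀ X, X ∉ boxN (n + 1) L → (fun X => ((max (-(Θ X).re) 0 : ℝ) : ℂ)) X = 0 :=
      fun X hX => by simp [hΘ0 X hX]
    have h3 : ∀ X, X ∉ boxN (n + 1) L → (fun X => ((max (Θ X).im 0 : ℝ) : ℂ)) X = 0 :=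
      fun X hX => by simp [hΘ0 X hX]
    have h4 : ∀ X, X ∉ boxN (n + 1) L → (fun X => ((max (-(Θ X).im) 0 : ℝ) : ℂ)) X = 0 :=
      fun X hX => by simp [hΘ0 X hX]
    have hΘm : Measurable Θ := hΘ.measurable
    have hL3 : ENNReal.ofReal ((L ^ 3)⁻¹) * ENNReal.ofReal (L ^ 3) = 1 := by
      rw [← ENNReal.ofReal_mul (by positivity), inv_mul_cancel₀ (by positivity), ENNReal.ofReal_one]
    rw [occupation_flatMode_eq hL h1, occupation_flatMode_eq hL h2, occupation_flatMode_eq hL h3,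
      occupation_flatMode_eq hL h4, occupation_flatMode_eq hL hΘ0, Nat.cast_succ,
      ← lintegral_lintegral_sq_nnnorm_vecCons hΘm]
    refine combine (n + 1 : ℝ≥0∞) (measurable_lintegral_sq_nnnorm_vecCons hΘm) hL3 fun Y => ?_
    exact oneBody hL.le (hΘ.comp (continuous_id.matrixVecCons continuous_const))
      (fun x hx => slice_eq_zero hΘ0 Y hx)

end Summit.AtomisticToContinuum.BoseEinsteinCondensation.Cruxes.HardSphereBEC.Birth

end
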